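import Summits.QuantumFields.YangMills.Theorems.BalabanUVNodesN07DbarNearRowsTop
import Summits.QuantumFields.YangMills.Theorems.BalabanUVNodesN07SymCurrencyReaderPhi
import Summits.QuantumFields.YangMills.Theorems.BalabanUVNodesN07DbarFrameTowerClosedForm
import HarnessLib

/-!
# N07 [B11] (= [15] = [Balaban1985Variational]) Sect. F — MODULE 96′ (plan g93 WORD A3⁵ = ρ3 «φ-FORM», director №310 (ii); chart side (III)-2): **THE TOP NEAR ROWS OF `U̿^{(j)}(U^u)♮` IN THE
# SYMMETRIC CURRENCY UNDER THE φ-b₂ PREMISE, AT THE RECORD, EVERY LETTER SUPPLIED** — MODULE 96 (`…N07DbarNearRowsTop`) re-cut under №311a (β): the normalisation premise is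
# `NrmSymPhiOfRecord … ψ` ((c-ii)′: «`‖R̄^{j′}(h̄·w·u⁻¹) − 1‖ ≤ ψ`» on the cells of print's OWN family `D″`); the reading is MODULE 93″'s twisted identity
# `U̿ = (V c₋)⁻¹S(c₋)ρ̄(c₋)⁻¹·Ū_eml((U^{h̄w})♮)·ρ̄(c₊)S(c₊)⁻¹V c₊` at EVERY top constraint bond with `‖ρ̄ − 1‖ ≤ 6ψ` at both ends (no out-end frame factor, no widening); the representative's top row `r`
# is MODULE 96's, the two `Ψ`-costs are the φ-LETTER `φ := 100·(240ℓ²·κε_jL)²` ((c-iii) ✓p744034): `‖U̿^{(j)}(U^u)♮(c) − 1‖ ≤ r + (ω + ω + ω·ω)·(1 + r)`, `ω := φ + 6ψ + φ·(6ψ)`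

Cell `pub-ymgap`, seat `pub-ymgap-dag-n07-e` g30 (FAN-OUT §N07 row s3; LANE OWNER of the K0 road chart side).  `--kind proof --supports stmt-QuantumFields-20541 --as helper` (K0⁷);
count-neutral; ONE theorem, no definition.  [15] = [Balaban1985Variational]; [6] = [Balaban1985RegularSpaces]; [3] = [Balaban1985Averaging]; [4] = [Balaban1984PropagatorsII];
[B5] = [Balaban1988Convergent]; [I] = [Balaban1987RG1].

WHY.  Under №311a (β) the premise of record `HThm4RecSym152Phi` carries row 9′ `NrmSymPhiOfRecord … ψ … u A` (S3's gauge normalised in print's own currency UP TO `ψ` on the cells of `D″`,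
`g = h̄·w·u⁻¹`, `w` the residual with `symCd`-axial tower; `ψ = ψ₂` the (B′) road's second-order cross term).  MODULE 93″ reads the double-bar averages at every `c : BondIdx D″` as
`(Ψρ̄)(c₋)⁻¹·Ū^{(l)}_{eml}((U^{h̄w})♮)(c)·(ρ̄Ψ…)(c₊)` with `‖ρ̄ − 1‖ ≤ 6ψ`, `Ψ = S⁻¹V`
(UST's accumulated frames `V` against print's sheared frames `S` for the averaged contour datum), and (c-iii) bounds `‖V − S‖` by `100·σ²`, `σ = 120ℓ²Lʲs₀`, from the reads
`‖U^u(b) − 1‖ ≤ s₀ = 2η·κε_jL` under the bond's two blocks ((T1)∕(T2) through MODULE 95's `landau_reads_of_tower`).  At the top level the representative's average is the top datum in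
the rooted axial gauge, `M^j(U^{h̄w})(c) = (M^jU)^h(c)` (`w` residual, `h̄` block-constant), within MODULE 96's `r` of `1` on the window (62″).  So the dbar-currency's out-end frame `f`
(⚑ LOCATED-OUT-END-FRAME, cured there by widening) is simply ABSENT: both ends pay the same second-order `ω = φ + 6ψ + 6φψ`.

WHAT IS PROVED (sorry-free; no `def`; axioms standard).  ★★★ `norm_dbar_sub_one_top_le_symPhi (F N)`: for the record run `s` (separated, nested + block-saturated, (W7a) floor), a
meeting, print-margin-clean datum `(m+1, idx)` with a non-wrapping window, the minimiser `U` on the fibre of multi-scale data `W` with `DataSmall7PTop … δ W`, numeric guards on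
`a₁ ≥ δ` and on `κ·ε·L` (`60ℓ²κεL < δ_N`, `5760ℓ²κεL < δ_F`, `2880ℓ²κεL < δ_N`, `240ℓ²κεL ≤ 10⁻⁴`), S3's gauge `(u, A)` with (T1)∕(T2) and `NrmSymPhiOfRecord … ψ … (m+1) idx u A`
(`0 ≤ ψ ≤ 1∕32`), `Adm22 D″ R M_b` with `2L ≤ R·M_b + 1` (FILE D0's instance at the knit): for every `c` with `D″.LamBond (m+1) c`,
`‖U̿^{(m+1)}(U^u)♮(c) − 1‖ ≤ r + (ω + ω + ω·ω)·(1 + r)`, `r = (d−1)·crad·((1+2C_L)·δ_{m+1})` (MODULE 96's), `ω = φ + 6ψ + φ·(6ψ)`, `φ = 100·(240ℓ²·κεL)²`.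
HONEST SCOPE.  Assembly BY NAME of MODULES 93″ ∕ (c-iii) ∕ 95 ∕ 96's row; nothing of [15]∕[6]∕[3] analysis asserted beyond those files; the DENT near rows (97′: the representative's level-`m`
rows for the `symCd`-axial tower = n07-w3's (j-i′)) and the assembly 98′∕99′ are NOT in this file; `NrmSymPhiOfRecord` is a displayed premise row (CONDITIONAL, N05's (B′) road); K0⁷ ∕ K1⁹ NOT
closed; N07 NOT discharged; counts unmoved (typed 28∕28 · discharged 8∕28); one finite 𝕋⁴ programme at fixed ε — the route closes the conditional finite-𝕋⁴ rung `BalabanLadder.UV` ONLY;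
the YM mass gap (Clay) is NOT proved by any of this; nothing continuum ∕ ℝ⁴ ∕ OS.  No `sorry`, no `def`, no `instance`, no `notation`.

References: [15] (144) p. 300, (147)–(154) pp. 301–302, (160) p. 303; [6] Lemma 1 (1.25) p. 79, (1.29) p. 81, p. 98, (1.129)–(1.131) pp. 98–99; [3] (11) p. 19, (78)–(88) pp. 30–31,
(92) p. 31, (97)–(100) p. 32, (110) p. 34, Prop. 4 p. 38; [4] (2.1)–(2.3) p. 224; [B5] (2.2) p. 255, (2.10)–(2.13) pp. 255–257; [I] (0.4)–(0.11) p. 253.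
-/

set_option autoImplicit false

noncomputable section

open scoped BigOperators Matrix.Norms.L2Operator
open NormedSpace

namespace Summit.QuantumFields.YangMills.BalabanUVNodes.N07SymNearRowsTopPhi

open Literature.MathematicalPhysics.QuantumFieldTheory.Balaban1983to89
open Literature.MathematicalPhysics.QuantumFieldTheory.Balaban1983to89.Node00
open Literature.MathematicalPhysics.QuantumFieldTheory.Balaban1983to89.B15DeterminingSets
open T4Continuum (T4Family)
open T4AxialGaugeSmallField (castSite)
open T4AxialGaugeRooted (axialGaugeAt)
open B12GaugeOrbits021 (IsResidual iter_gaugeAct_of_isResidual)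
open B15Eq177GaugeInvariance (blockLift)
open B16Sect1Backgrounds (toMS)
open B15Eq112TorusCover (cover)
open B14DomainGeom (Pt Within)
open B7Prop1Local (InBox)
open B8Eq131Cubes (box cube sqLo sqHi tLo tHi ctr crad ctr_mem)
open B5Eq118OneStroke (iterBlockOf iterBlockOf_succ)
open B6SectADomainsV1 (Domains)
open B6SectAOperatorsV1 (BondIdx)
open B10Eq27TorusAxialLog (unitsField toUField gaugeActT val_unitsField)
open B12RegularSpaces111 (gaugeU expI)
open GaugeField (gaugeAct)
open ExpMeanLog (expMeanLogSU deltaSU)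
open FederbushMean (federbushSU deltaFed federbushSU_δ dist1_SU_eq)
open Summit.QuantumFields.YangMills.Theorems.FlatCubeOpsText (Adm22)
open Summit.QuantumFields.YangMills.Theorems.Prop8Chart (emlIterU expCfg)
open Summit.QuantumFields.YangMills.Theorems.Prop8ChartDoubleBar (vframeU dbarIterU)
open Summit.QuantumFields.YangMills.BalabanUVNodes.N07NormalisationDbarFrames (toUT)
open Summit.QuantumFields.YangMills.BalabanUVNodes.N07NormalisationSymOfRecord (symCd)
open Summit.QuantumFields.YangMills.BalabanUVNodes.N07Thm4RecordStructureSym152Phi (NrmSymPhiOfRecord)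
open Summit.QuantumFields.YangMills.BalabanUVNodes.N07SymCurrencyReaderPhi (NrmSymPhiOfRecord.dbar_eq_conj_twist_lamBond)
open Summit.QuantumFields.YangMills.BalabanUVNodes.N07NormalisationWideRows (dist1_gaugeAct_axialGaugeAt_le_of_mem_boxBonds abs_sub_ctr_le_crad Icc_chartBox_subset_Icc_printWindow)
open Summit.QuantumFields.YangMills.BalabanUVNodes.N07ShearSizeTopBox (mem_boxBonds_of_ends_mem_box)
open Summit.QuantumFields.YangMills.BalabanUVNodes.N07PrintWindowDataSmall (plaqSmallOn_printWindow_iter_of_data)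
open Summit.QuantumFields.YangMills.BalabanUVNodes.N09AxialSelectionExists (iter_gaugeAct_blockLift)
open Summit.QuantumFields.YangMills.BalabanUVNodes.N07FarRowsOfTowerLetters (exists_collar_labels_of_lamBond_meet)
open Summit.QuantumFields.YangMills.BalabanUVNodes.N07DbarDictionaryTransfer (emlIterU_unitsField_eq_iter_of_reads₂ emlIterU_eq_iter_apply_of_gaugeAct landau_reads_of_tower)
open Summit.QuantumFields.YangMills.BalabanUVNodes.N07SymCurrencyReader (norm_inv_mul_toUT_sub_one_eq norm_toUT_inv_mul_sub_one_eq norm_conj3_sub_one_le)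
open Summit.QuantumFields.YangMills.BalabanUVNodes.N07DbarFrameTowerOfReads (val_accFrame_mem_unitary)
open Summit.QuantumFields.YangMills.BalabanUVNodes.N07DbarFrameTowerClosedForm (norm_accFrame_sub_shearRIter_le_record)

section Record

variable (F : T4Family) (N : ℕ) [NeZero N]

/-- ★★★ **THE TOP NEAR ROWS OF `U̿^{(j)}(U^u)♮` UNDER THE φ-b₂ PREMISE, AT THE RECORD** (statement in the header): for every top constraint bond `c` of print's family `D″` at a meeting,
print-margin-clean datum `(m+1, idx)`, `‖U̿^{(m+1)}(U^u)♮(c) − 1‖ ≤ r + (ω + ω + ω·ω)·(1 + r)`, `r = (d−1)·crad·((1+2C_L)·δ_{m+1})`, `ω = φ + 6ψ + φ·(6ψ)`, `φ = 100·(240ℓ²·κεL)²`.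
[cite: Balaban1985Variational, (160) p.303, (147) p.301, (150)–(154) pp.301–302; Balaban1985Averaging, (78)–(88) pp.30–31, (92) p.31, (97)–(100) p.32, (110) p.34; Balaban1985RegularSpaces, Lemma 1 (1.25) p.79, (1.29) p.81, p.98, (1.131) p.99; Balaban1984PropagatorsII, (2.1)–(2.3) p.224; Balaban1987RG1, (0.4)–(0.11) p.253] -/
theorem norm_dbar_sub_one_top_le_symPhi {ν : Stage7Numerics} {M : ℕ} {g : ℕ → ℝ} {K k : ℕ} (s : SeqOfRecord F ν M g K k)
    (hsep : Sect2.SeqSeparated ν.M₁ s) (hkK : k ≤ (F.P K).m + (F.P K).K)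
    (hgrid : ∀ j : ℕ, 1 ≤ j → j ≤ k → dCubeSide (F.P K).L M (RkOfRecord (F.P K).L ν.r (g j)) j ∣ (F.P K).sitesPerDir 0)
    {Mc ρ : ℕ} (hMc : 1 ≤ Mc) (hρ : 1 ≤ ρ) (hLρ : (F.P K).L ≤ ρ) (hfloor : (11 * (F.P K).d + 4 * ρ + Mc) * (F.P K).L + 3 ≤ ν.M₁)
    {δ : ℕ → ℝ} {a₁ : ℝ} (hδ : ∀ n, n ≤ k → 0 < δ n ∧ δ n ≤ a₁) (hcompδ : ∀ n, n < k → δ n ≤ 2 * δ (n + 1))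
    (hguard : (((((F.P K).d + 2) * (F.P K).L : ℕ) : ℝ) ^ 2 / 4) * ((4 * (((((F.P K).d - 1 : ℕ) : ℝ)) * ((2 * (F.P K).L - 1 : ℕ) : ℝ)) + 1) * a₁) < deltaSU (Fin N))
    (W : MSField (F.P K) (SU N)) (h7 : Sect2.DataSmall7PTop (avOfRecord F N K) s.Ω (suppDomOfRecord F ν K s.Ω) k δ W)
    (U : GaugeField (F.P K) 0 (SU N)) (hfib : AgreeOn (genSet s.Ω k) (avgFamily (avOfRecord F N K) U) W)
    {m : ℕ} (hjk : m + 1 ≤ k) (hjK : m + 1 + 1 ≤ (F.P K).m + (F.P K).K) (idx : Pt (F.P K).d)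
    (hmeet : ∃ x ∈ box (F.P K).L (cornerP (F.P K) Mc ρ idx) (sideP (F.P K) Mc ρ) (m + 1), ∃ y : Pt (F.P K).d, cover (F.P K) y ∈ s.Ω (m + 1) ∧ Within ((3 : ℕ) : ℤ) x y)
    (hclean : m + 1 = k ∨ ∀ z ∈ box (F.P K).L (cornerP (F.P K) Mc ρ idx - ((2 * ρ : ℕ) : Pt (F.P K).d)) (sideP (F.P K) Mc ρ + 2 * (2 * ρ)) (m + 1),
      cover (F.P K) z ∉ s.Ω (m + 1 + 1))
    {n₀ : ℕ} (hn : ∀ κ, (tHi (cornerP (F.P K) Mc ρ idx) (sideP (F.P K) Mc ρ) ρ) κ ≤ (tLo (cornerP (F.P K) Mc ρ idx) ρ) κ + n₀) (hnN : n₀ + 1 < (F.P K).sitesPerDir (m + 1))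
    -- the Landau copy `(u, A)` at the datum: the S3 door's rows (T1)∕(T2) and the numeric budgets of the dictionary and of the φ-letter
    (u : GaugeTransf (F.P K) 0 (SU N)) (A : PBond (F.P K) 0 → MatA N) {κ ε' : ℝ} (hκ : 0 ≤ κ) (hε' : 0 ≤ ε')
    (hT1 : ∀ b ∈ (Sect2.regionOfSet (F.P K) (cover (F.P K) '' cube (F.P K).L (cornerP (F.P K) Mc ρ idx) (sideP (F.P K) Mc ρ) ρ (m + 1) 0)).bonds,
      gaugeU (fun x => ιSU N (u x)) (fun b' => ιSU N (U b')) b = expI ((F.P K).eta (m + 1)) (A b))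
    (hT2 : ∀ j', j' ≤ m + 1 → ∀ b ∈ (Sect2.regionOfSet (F.P K) (cover (F.P K) '' cube (F.P K).L (cornerP (F.P K) Mc ρ idx) (sideP (F.P K) Mc ρ) ρ (m + 1) j')).bonds,
      ‖A b‖ < κ * ε' * ((F.P K).L : ℝ) ^ (m + 1 - j'))
    (hgd : 60 * ((((F.P K).d + 2) * (F.P K).L : ℕ) : ℝ) ^ 2 * (κ * ε' * ((F.P K).L : ℝ)) < deltaSU (Fin N))
    (hσF : 5760 * ((((F.P K).d + 2) * (F.P K).L : ℕ) : ℝ) ^ 2 * (κ * ε' * ((F.P K).L : ℝ)) < deltaFed (Fin N))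
    (hσS : 2880 * ((((F.P K).d + 2) * (F.P K).L : ℕ) : ℝ) ^ 2 * (κ * ε' * ((F.P K).L : ℝ)) < deltaSU (Fin N))
    (hσ4 : 240 * ((((F.P K).d + 2) * (F.P K).L : ℕ) : ℝ) ^ 2 * (κ * ε' * ((F.P K).L : ℝ)) ≤ 1 / 10000)
    -- the normalisation of record (ρ3: MODULE 87, print's own family `D″`) and the (2.2) collar of `D″`
    (hk : m + 1 ≤ (F.P K).m + (F.P K).K) {ψ : ℝ} (hψ0 : 0 ≤ ψ) (hψ : ψ ≤ 1 / 32) (hN : NrmSymPhiOfRecord F N Mc ρ ψ ν M g K k s U (m + 1) idx u A) {R Mb : ℕ}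
    (hAdm : Adm22 (domainsMeet (cubeDomains (F.P K) (cornerP (F.P K) Mc ρ idx) (sideP (F.P K) Mc ρ) ρ (m + 1) hk) (domainsOfSeq s.Ω (m + 1) hk)) R Mb)
    (hRM : 2 * (F.P K).L ≤ R * Mb + 1)
    -- ANY family of accumulated double-bar frames of the Landau copy ([3] (97); e.g. the recursion's own)
    (V : (i : ℕ) → Site (F.P K) i → (Matrix (Fin N) (Fin N) ℂ)ˣ) (hV0 : ∀ x, V 0 x = 1)
    (hVs : ∀ (i : ℕ) (y : Site (F.P K) (i + 1)), V (i + 1) y = V i (emb y) * vframeU (dbarIterU i (unitsField (toUField (gaugeAct u U)))) y)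
    -- the top constraint bond of `D″`
    (c : PBond (F.P K) (m + 1))
    (hc : (domainsMeet (cubeDomains (F.P K) (cornerP (F.P K) Mc ρ idx) (sideP (F.P K) Mc ρ) ρ (m + 1) hk) (domainsOfSeq s.Ω (m + 1) hk)).LamBond (m + 1) c) :
    ‖((dbarIterU (m + 1) (unitsField (toUField (gaugeAct u U))) c : (MatA N)ˣ) : MatA N) - 1‖ ≤
      (((F.P K).d - 1 : ℕ) : ℝ) * (crad (sideP (F.P K) Mc ρ) ρ : ℕ) *
          ((1 + 2 * ((((F.P K).L : ℝ) ^ 2 + 6 * ((((F.P K).d + 2) * (F.P K).L : ℕ) : ℝ) ^ 2) * (4 * (((((F.P K).d - 1 : ℕ) : ℝ)) * ((2 * (F.P K).L - 1 : ℕ) : ℝ)) + 1))) * δ (m + 1)) +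
        ((100 * (240 * ((((F.P K).d + 2) * (F.P K).L : ℕ) : ℝ) ^ 2 * (κ * ε' * ((F.P K).L : ℝ))) ^ 2 + 6 * ψ + 100 * (240 * ((((F.P K).d + 2) * (F.P K).L : ℕ) : ℝ) ^ 2 * (κ * ε' * ((F.P K).L : ℝ))) ^ 2 * (6 * ψ)) +
            (100 * (240 * ((((F.P K).d + 2) * (F.P K).L : ℕ) : ℝ) ^ 2 * (κ * ε' * ((F.P K).L : ℝ))) ^ 2 + 6 * ψ + 100 * (240 * ((((F.P K).d + 2) * (F.P K).L : ℕ) : ℝ) ^ 2 * (κ * ε' * ((F.P K).L : ℝ))) ^ 2 * (6 * ψ)) +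
            (100 * (240 * ((((F.P K).d + 2) * (F.P K).L : ℕ) : ℝ) ^ 2 * (κ * ε' * ((F.P K).L : ℝ))) ^ 2 + 6 * ψ + 100 * (240 * ((((F.P K).d + 2) * (F.P K).L : ℕ) : ℝ) ^ 2 * (κ * ε' * ((F.P K).L : ℝ))) ^ 2 * (6 * ψ)) *
              (100 * (240 * ((((F.P K).d + 2) * (F.P K).L : ℕ) : ℝ) ^ 2 * (κ * ε' * ((F.P K).L : ℝ))) ^ 2 + 6 * ψ + 100 * (240 * ((((F.P K).d + 2) * (F.P K).L : ℕ) : ℝ) ^ 2 * (κ * ε' * ((F.P K).L : ℝ))) ^ 2 * (6 * ψ))) *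
          (1 + (((F.P K).d - 1 : ℕ) : ℝ) * (crad (sideP (F.P K) Mc ρ) ρ : ℕ) *
            ((1 + 2 * ((((F.P K).L : ℝ) ^ 2 + 6 * ((((F.P K).d + 2) * (F.P K).L : ℕ) : ℝ) ^ 2) * (4 * (((((F.P K).d - 1 : ℕ) : ℝ)) * ((2 * (F.P K).L - 1 : ℕ) : ℝ)) + 1))) * δ (m + 1))) := by
  -- ### letters
  have hℓ0 : (0 : ℝ) ≤ ((((F.P K).d + 2) * (F.P K).L : ℕ) : ℝ) := Nat.cast_nonneg _
  have hℓ1 : (1 : ℝ) ≤ ((((F.P K).d + 2) * (F.P K).L : ℕ) : ℝ) := by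
    exact_mod_cast Nat.one_le_iff_ne_zero.mpr (Nat.mul_ne_zero (by omega) (by have := (F.P K).hL.2; omega))
  have hCL0 : (0 : ℝ) ≤ 1 + 2 * ((((F.P K).L : ℝ) ^ 2 + 6 * ((((F.P K).d + 2) * (F.P K).L : ℕ) : ℝ) ^ 2) *
      (4 * (((((F.P K).d - 1 : ℕ) : ℝ)) * ((2 * (F.P K).L - 1 : ℕ) : ℝ)) + 1)) := by positivity
  have hδj : 0 < δ (m + 1) := (hδ (m + 1) hjk).1
  have hsA0 : 0 ≤ κ * ε' * ((F.P K).L : ℝ) := by positivity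
  -- ### the witness `w` (residual, `symCd`-axial tower) and MODULE 93′'s reading on `BondIdx D″`, for the accumulated frames of `(U^u)♮`
  obtain ⟨w, hres, -, hid⟩ := NrmSymPhiOfRecord.dbar_eq_conj_twist_lamBond hψ0 hψ hN hk hAdm hRM V hV0 hVs
  set h : GaugeTransf (F.P K) (m + 1) (SU N) := axialGaugeAt (Averaging.iter (avOfRecord F N K) (m + 1) (gaugeAct w U))
    (tLo (cornerP (F.P K) Mc ρ idx) ρ) (tHi (cornerP (F.P K) Mc ρ idx) (sideP (F.P K) Mc ρ) ρ) (ctr (cornerP (F.P K) Mc ρ idx) (sideP (F.P K) Mc ρ)) with hh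
  set gw : GaugeTransf (F.P K) 0 (SU N) := fun x => blockLift (m + 1) h x * w x with hgw
  -- the representative `U″ = U^{gw}`: top `(M^j U)^h`
  set U'' : GaugeField (F.P K) 0 (SU N) := gaugeAct gw U with hU''
  have hU''2 : U'' = gaugeAct (blockLift (m + 1) h) (gaugeAct w U) := by
    rw [hU'', hgw, ← T3UnitLawGaugeInvariance.gaugeAct_gaugeAct]
  have hresid : Averaging.iter (avOfRecord F N K) (m + 1) (gaugeAct w U) = Averaging.iter (avOfRecord F N K) (m + 1) U :=
    iter_gaugeAct_of_isResidual (avOfRecord F N K) hk hres U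
  have htop : Averaging.iter (avOfRecord F N K) (m + 1) U'' = gaugeAct h (Averaging.iter (avOfRecord F N K) (m + 1) U) := by
    rw [hU''2, iter_gaugeAct_blockLift (avOfRecord F N K) hk h (gaugeAct w U), hresid]
  -- ### geometry of the bond: collar labels of its two ends (78); the box bond of the window (62″)
  obtain ⟨sl, sl', hsrc, htgt, hsl, hsl'⟩ := exists_collar_labels_of_lamBond_meet (domainsOfSeq s.Ω (m + 1) hk) (by omega : 1 ≤ m + 1) le_rfl hc
  have hIcc := Icc_chartBox_subset_Icc_printWindow (F.P K).L (cornerP (F.P K) Mc ρ idx) (sideP (F.P K) Mc ρ) hρ (m + 1)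
  have hslI : sl ∈ Set.Icc (sqLo (F.P K).L (cornerP (F.P K) Mc ρ idx) ρ (m + 1) (m + 1) - 1) (sqHi (F.P K).L (cornerP (F.P K) Mc ρ idx) (sideP (F.P K) Mc ρ) ρ (m + 1) (m + 1) + 1) :=
    ⟨fun i => (hsl i).1, fun i => (hsl i).2⟩
  have hslI' : sl' ∈ Set.Icc (sqLo (F.P K).L (cornerP (F.P K) Mc ρ idx) ρ (m + 1) (m + 1) - 1) (sqHi (F.P K).L (cornerP (F.P K) Mc ρ idx) (sideP (F.P K) Mc ρ) ρ (m + 1) (m + 1) + 1) :=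
    ⟨fun i => (hsl' i).1, fun i => (hsl' i).2⟩
  have hslw : sl ∈ Set.Icc (tLo (cornerP (F.P K) Mc ρ idx) ρ) (tHi (cornerP (F.P K) Mc ρ idx) (sideP (F.P K) Mc ρ) ρ) := hIcc hslI
  have hslw' : sl' ∈ Set.Icc (tLo (cornerP (F.P K) Mc ρ idx) ρ) (tHi (cornerP (F.P K) Mc ρ idx) (sideP (F.P K) Mc ρ) ρ) := hIcc hslI'
  -- ### the reads of the Landau copy under the two blocks of `c` (95 §3)
  have hη0 : 0 ≤ (F.P K).eta (m + 1) := by unfold Params.eta; positivity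
  have hpow : (m + 1) - (m + 1 - 1) = 1 := by omega
  have hLη : ((F.P K).L : ℝ) ^ (m + 1) * (F.P K).eta (m + 1) = 1 := B12Eq115BackgroundPair.pow_mul_eta (F.P K) (m + 1)
  have hℓ2 : (1 : ℝ) ≤ ((((F.P K).d + 2) * (F.P K).L : ℕ) : ℝ) ^ 2 := one_le_pow₀ hℓ1
  have hxℓ : κ * ε' * ((F.P K).L : ℝ) ≤ ((((F.P K).d + 2) * (F.P K).L : ℕ) : ℝ) ^ 2 * (κ * ε' * ((F.P K).L : ℝ)) := by
    have := mul_le_mul_of_nonneg_right hℓ2 hsA0; linarith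
  have hxℓℓ : ((((F.P K).d + 2) * (F.P K).L : ℕ) : ℝ) * (κ * ε' * ((F.P K).L : ℝ)) ≤ ((((F.P K).d + 2) * (F.P K).L : ℕ) : ℝ) ^ 2 * (κ * ε' * ((F.P K).L : ℝ)) := by
    have hℓℓ : ((((F.P K).d + 2) * (F.P K).L : ℕ) : ℝ) ≤ ((((F.P K).d + 2) * (F.P K).L : ℕ) : ℝ) ^ 2 := by
      rw [sq]; exact le_mul_of_one_le_left hℓ0 hℓ1
    exact mul_le_mul_of_nonneg_right hℓℓ hsA0
  have hηsA : (F.P K).eta (m + 1) * (κ * ε' * ((F.P K).L : ℝ)) ≤ 1 := by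
    have hη1 : (F.P K).eta (m + 1) ≤ 1 := by
      unfold Params.eta
      exact pow_le_one₀ (by positivity) (inv_le_one_of_one_le₀ (by exact_mod_cast (F.P K).L_pos))
    have h1 : κ * ε' * ((F.P K).L : ℝ) ≤ 1 := by linarith [hxℓ, hσ4]
    calc (F.P K).eta (m + 1) * (κ * ε' * ((F.P K).L : ℝ)) ≤ 1 * (κ * ε' * ((F.P K).L : ℝ)) := mul_le_mul_of_nonneg_right hη1 hsA0
      _ ≤ 1 := by linarith
  have hreads : ∀ b : PBond (F.P K) 0, (iterBlockOf (m + 1) b.src = c.src ∨ iterBlockOf (m + 1) b.src = c.tgt) →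
      (iterBlockOf (m + 1) b.tgt = c.src ∨ iterBlockOf (m + 1) b.tgt = c.tgt) →
      unitsField (toUField (gaugeAct u U)) b = expCfg ((F.P K).eta (m + 1)) A b ∧ ‖A b‖ < κ * ε' * ((F.P K).L : ℝ) ∧
        ‖((unitsField (toUField (gaugeAct u U)) b : (MatA N)ˣ) : MatA N) - 1‖ ≤ 2 * ((F.P K).eta (m + 1) * (κ * ε' * ((F.P K).L : ℝ))) := by
    intro b hbs hbt
    rw [hsrc, htgt] at hbs hbt
    obtain ⟨h1, h2, h3⟩ := landau_reads_of_tower (k := m + 1) hk hLρ (by omega) le_rfl U u A hη0 hT1 hT2 hsl hsl' b hbs hbt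
    rw [hpow, pow_one] at h2 h3
    exact ⟨h1, h2, h3 hηsA⟩
  -- ### the dictionary for `U^u` at `c`, transferred to `U″`
  have hs00 : 0 ≤ 2 * ((F.P K).eta (m + 1) * (κ * ε' * ((F.P K).L : ℝ))) := by positivity
  -- the read letter at the top: `120ℓ²L^{m+1}s₀ = 240ℓ²·κε′L`
  have hσeq : 120 * ((((F.P K).d + 2) * (F.P K).L : ℕ) : ℝ) ^ 2 * ((F.P K).L : ℝ) ^ (m + 1) * (2 * ((F.P K).eta (m + 1) * (κ * ε' * ((F.P K).L : ℝ)))) =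
      240 * ((((F.P K).d + 2) * (F.P K).L : ℕ) : ℝ) ^ 2 * (κ * ε' * ((F.P K).L : ℝ)) := by
    have e : 120 * ((((F.P K).d + 2) * (F.P K).L : ℕ) : ℝ) ^ 2 * ((F.P K).L : ℝ) ^ (m + 1) * (2 * ((F.P K).eta (m + 1) * (κ * ε' * ((F.P K).L : ℝ)))) =
        240 * ((((F.P K).d + 2) * (F.P K).L : ℕ) : ℝ) ^ 2 * (κ * ε' * ((F.P K).L : ℝ)) * (((F.P K).L : ℝ) ^ (m + 1) * (F.P K).eta (m + 1)) := by ring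
    rw [e, hLη, mul_one]
  have hxeq : ((F.P K).L : ℝ) ^ (m + 1) * (2 * ((F.P K).eta (m + 1) * (κ * ε' * ((F.P K).L : ℝ)))) = 2 * (κ * ε' * ((F.P K).L : ℝ)) := by
    have e : ((F.P K).L : ℝ) ^ (m + 1) * (2 * ((F.P K).eta (m + 1) * (κ * ε' * ((F.P K).L : ℝ)))) =
        2 * (κ * ε' * ((F.P K).L : ℝ)) * (((F.P K).L : ℝ) ^ (m + 1) * (F.P K).eta (m + 1)) := by ring
    rw [e, hLη, mul_one]
  have hbud' : 6400 * ((((F.P K).d + 2) * (F.P K).L : ℕ) : ℝ) ^ 2 * ((F.P K).L : ℝ) ^ (m + 1) * (2 * ((F.P K).eta (m + 1) * (κ * ε' * ((F.P K).L : ℝ)))) ≤ 1 := by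
    have e : 6400 * ((((F.P K).d + 2) * (F.P K).L : ℕ) : ℝ) ^ 2 * ((F.P K).L : ℝ) ^ (m + 1) * (2 * ((F.P K).eta (m + 1) * (κ * ε' * ((F.P K).L : ℝ)))) =
        6400 * ((((F.P K).d + 2) * (F.P K).L : ℕ) : ℝ) ^ 2 * (((F.P K).L : ℝ) ^ (m + 1) * (2 * ((F.P K).eta (m + 1) * (κ * ε' * ((F.P K).L : ℝ))))) := by ring
    rw [e, hxeq]
    linarith [hσ4]
  have hbudget' : 8 * 3800 * ((((F.P K).d + 2) * (F.P K).L : ℕ) : ℝ) ^ 2 * ((F.P K).L : ℝ) ^ (m + 1) * (2 * ((F.P K).eta (m + 1) * (κ * ε' * ((F.P K).L : ℝ)))) ≤ 1 := by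
    have e : 8 * 3800 * ((((F.P K).d + 2) * (F.P K).L : ℕ) : ℝ) ^ 2 * ((F.P K).L : ℝ) ^ (m + 1) * (2 * ((F.P K).eta (m + 1) * (κ * ε' * ((F.P K).L : ℝ)))) =
        8 * 3800 * ((((F.P K).d + 2) * (F.P K).L : ℕ) : ℝ) ^ 2 * (((F.P K).L : ℝ) ^ (m + 1) * (2 * ((F.P K).eta (m + 1) * (κ * ε' * ((F.P K).L : ℝ))))) := by ring
    rw [e, hxeq]
    linarith [hσ4]
  have hgd' : 30 * ((((F.P K).d + 2) * (F.P K).L : ℕ) : ℝ) ^ 2 * ((F.P K).L : ℝ) ^ (m + 1) * (2 * ((F.P K).eta (m + 1) * (κ * ε' * ((F.P K).L : ℝ)))) <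
      deltaSU (Fin N) := by
    have e : 30 * ((((F.P K).d + 2) * (F.P K).L : ℕ) : ℝ) ^ 2 * ((F.P K).L : ℝ) ^ (m + 1) * (2 * ((F.P K).eta (m + 1) * (κ * ε' * ((F.P K).L : ℝ)))) =
        30 * ((((F.P K).d + 2) * (F.P K).L : ℕ) : ℝ) ^ 2 * (((F.P K).L : ℝ) ^ (m + 1) * (2 * ((F.P K).eta (m + 1) * (κ * ε' * ((F.P K).L : ℝ))))) := by ring
    rw [e, hxeq]; linarith
  have hguard8 : 8 * ((((F.P K).d + 2) * (F.P K).L : ℕ) : ℝ) * ((F.P K).L : ℝ) ^ (m + 1) * (2 * ((F.P K).eta (m + 1) * (κ * ε' * ((F.P K).L : ℝ)))) <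
      deltaSU (Fin N) := by
    have e : 8 * ((((F.P K).d + 2) * (F.P K).L : ℕ) : ℝ) * ((F.P K).L : ℝ) ^ (m + 1) * (2 * ((F.P K).eta (m + 1) * (κ * ε' * ((F.P K).L : ℝ)))) =
        8 * ((((F.P K).d + 2) * (F.P K).L : ℕ) : ℝ) * (((F.P K).L : ℝ) ^ (m + 1) * (2 * ((F.P K).eta (m + 1) * (κ * ε' * ((F.P K).L : ℝ))))) := by ring
    rw [e, hxeq]
    linarith [hxℓℓ, hgd]
  have hσF' : 24 * (120 * ((((F.P K).d + 2) * (F.P K).L : ℕ) : ℝ) ^ 2 * ((F.P K).L : ℝ) ^ (m + 1) * (2 * ((F.P K).eta (m + 1) * (κ * ε' * ((F.P K).L : ℝ))))) <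
      (federbushSU (n := Fin N)).δ := by
    rw [hσeq, federbushSU_δ]; linarith
  have hσS' : 12 * (120 * ((((F.P K).d + 2) * (F.P K).L : ℕ) : ℝ) ^ 2 * ((F.P K).L : ℝ) ^ (m + 1) * (2 * ((F.P K).eta (m + 1) * (κ * ε' * ((F.P K).L : ℝ))))) <
      deltaSU (Fin N) := by
    rw [hσeq]; linarith
  have hσ4' : 120 * ((((F.P K).d + 2) * (F.P K).L : ℕ) : ℝ) ^ 2 * ((F.P K).L : ℝ) ^ (m + 1) * (2 * ((F.P K).eta (m + 1) * (κ * ε' * ((F.P K).L : ℝ)))) ≤ 1 / 10000 := by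
    rw [hσeq]; exact hσ4
  have hdict := emlIterU_unitsField_eq_iter_of_reads₂ hk (gaugeAct u U) c hs00 hbud' hgd' (fun b hbs hbt => (hreads b hbs hbt).2.2)
  have hdictc : emlIterU (m + 1) (unitsField (toUField (gaugeAct gw U))) c = unitsField (toUField (Averaging.iter (avOfRecord F N K) (m + 1) U'')) c :=
    emlIterU_eq_iter_apply_of_gaugeAct (avOfRecord F N K) hk U u gw c (hdict (m + 1) le_rfl c (fun _ hx => Or.inl hx) (fun _ hx => Or.inr hx)).1
  -- ### the row `r` at `c`: the rooted two-sided Poincaré bound on the window box (62″ §1) with 69b″'s data letter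
  have hV := plaqSmallOn_printWindow_iter_of_data F N s hsep hkK hgrid hMc hρ hfloor hδ hcompδ hguard W h7 U hfib (by omega : 1 ≤ m + 1) hjk hjK idx hmeet hclean
  have hS1 : 1 ≤ sideP (F.P K) Mc ρ := by have := le_sideP (P := F.P K) Mc hρ; omega
  obtain ⟨hr1, hr2, -⟩ := ctr_mem (a := cornerP (F.P K) Mc ρ idx) (ρ := ρ) hS1
  have hNwrap : ∀ κ', (tHi (cornerP (F.P K) Mc ρ idx) (sideP (F.P K) Mc ρ) ρ) κ' + 1 - (tLo (cornerP (F.P K) Mc ρ idx) ρ) κ' < (F.P K).sitesPerDir (m + 1) :=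
    fun κ' => by have := hn κ'; omega
  have hNwrap' : ∀ κ', (tHi (cornerP (F.P K) Mc ρ idx) (sideP (F.P K) Mc ρ) ρ) κ' - (tLo (cornerP (F.P K) Mc ρ idx) ρ) κ' < (F.P K).sitesPerDir (m + 1) :=
    fun κ' => by have := hn κ'; omega
  have hsrc' : c.src ∈ (castSite '' Set.Icc (tLo (cornerP (F.P K) Mc ρ idx) ρ) (tHi (cornerP (F.P K) Mc ρ idx) (sideP (F.P K) Mc ρ) ρ) : Set (Site (F.P K) (m + 1))) :=
    ⟨sl, hslw, hsrc.symm⟩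
  have htgt' : c.tgt ∈ (castSite '' Set.Icc (tLo (cornerP (F.P K) Mc ρ idx) ρ) (tHi (cornerP (F.P K) Mc ρ idx) (sideP (F.P K) Mc ρ) ρ) : Set (Site (F.P K) (m + 1))) :=
    ⟨sl', hslw', htgt.symm⟩
  have hcB := mem_boxBonds_of_ends_mem_box (P := F.P K) hNwrap hsrc' htgt'
  have hrow : dist1 (Averaging.iter (avOfRecord F N K) (m + 1) U'' c) ≤
      (((F.P K).d - 1 : ℕ) : ℝ) * (crad (sideP (F.P K) Mc ρ) ρ : ℕ) *
        ((1 + 2 * ((((F.P K).L : ℝ) ^ 2 + 6 * ((((F.P K).d + 2) * (F.P K).L : ℕ) : ℝ) ^ 2) * (4 * (((((F.P K).d - 1 : ℕ) : ℝ)) * ((2 * (F.P K).L - 1 : ℕ) : ℝ)) + 1))) *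
          δ (m + 1)) := by
    rw [htop, hh, hresid]
    exact dist1_gaugeAct_axialGaugeAt_le_of_mem_boxBonds (Averaging.iter (avOfRecord F N K) (m + 1) U) subset_rfl hV (mul_nonneg hCL0 hδj.le) hNwrap' hr1 hr2
      (fun x hx hx' κ' => abs_sub_ctr_le_crad hS1 x hx hx' κ') hcB
  have hE : ‖((emlIterU (m + 1) (unitsField (toUField (gaugeAct gw U))) c : (MatA N)ˣ) : MatA N) - 1‖ ≤
      (((F.P K).d - 1 : ℕ) : ℝ) * (crad (sideP (F.P K) Mc ρ) ρ : ℕ) *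
        ((1 + 2 * ((((F.P K).L : ℝ) ^ 2 + 6 * ((((F.P K).d + 2) * (F.P K).L : ℕ) : ℝ) ^ 2) * (4 * (((((F.P K).d - 1 : ℕ) : ℝ)) * ((2 * (F.P K).L - 1 : ℕ) : ℝ)) + 1))) *
          δ (m + 1)) := by
    rw [hdictc, val_unitsField]; exact hrow
  -- ### the φ-letter at the two ends: (L1″) from the reads under `T := {c₋, c₊}`
  have hUr : ∀ b : PBond (F.P K) 0, iterBlockOf (m + 1) b.src ∈ ({y | y = c.src ∨ y = c.tgt} : Set (Site (F.P K) (m + 1))) →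
      iterBlockOf (m + 1) b.tgt ∈ ({y | y = c.src ∨ y = c.tgt} : Set (Site (F.P K) (m + 1))) →
      ‖((gaugeAct u U b : SU N) : Matrix (Fin N) (Fin N) ℂ) - 1‖ ≤ 2 * ((F.P K).eta (m + 1) * (κ * ε' * ((F.P K).L : ℝ))) := by
    intro b hbs hbt
    have h := (hreads b hbs hbt).2.2
    rwa [val_unitsField] at h
  have hφ := norm_accFrame_sub_shearRIter_le_record F K hk ({y | y = c.src ∨ y = c.tgt} : Set (Site (F.P K) (m + 1))) (gaugeAct u U) hs00
    hbudget' hgd' hσF' hσS' hσ4' hUr V hV0 hVs (m + 1) le_rfl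
  have hVu := val_accFrame_mem_unitary ({y | y = c.src ∨ y = c.tgt} : Set (Site (F.P K) (m + 1))) hk (gaugeAct u U) hs00 hbudget' hguard8 hUr V hV0 hVs (m + 1) le_rfl
  have hgs : ∀ x : Site (F.P K) 0, iterBlockOf (m + 1) x = c.src → iterBlockOf (m + 1) x ∈ ({y | y = c.src ∨ y = c.tgt} : Set (Site (F.P K) (m + 1))) :=
    fun x hx => Or.inl hx
  have hgt : ∀ x : Site (F.P K) 0, iterBlockOf (m + 1) x = c.tgt → iterBlockOf (m + 1) x ∈ ({y | y = c.src ∨ y = c.tgt} : Set (Site (F.P K) (m + 1))) :=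
    fun x hx => Or.inr hx
  have hφs := hφ c.src hgs
  have hφt := hφ c.tgt hgt
  rw [hσeq] at hφs hφt
  -- ### assemble: MODULE 93′'s reading at `c`, conjugation costs `φ` at each end
  obtain ⟨hidc, hρs, hρt⟩ := hid (m + 1) c hc
  have hφ0 : (0 : ℝ) ≤ 100 * (240 * ((((F.P K).d + 2) * (F.P K).L : ℕ) : ℝ) ^ 2 * (κ * ε' * ((F.P K).L : ℝ))) ^ 2 := by positivity
  -- two-factor bookkeeping: `‖ab − 1‖ ≤ ‖a − 1‖ + ‖b − 1‖ + ‖a − 1‖·‖b − 1‖`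
  have two : ∀ (a b : Matrix (Fin N) (Fin N) ℂ) {α β : ℝ}, ‖a - 1‖ ≤ α → ‖b - 1‖ ≤ β → 0 ≤ α → ‖a * b - 1‖ ≤ α + β + α * β := by
    intro a b α β ha hb hα
    have hid : a * b - 1 = (a - 1) * (b - 1) + (a - 1) + (b - 1) := by noncomm_ring
    have h1 : ‖(a - 1) * (b - 1)‖ ≤ α * β := (norm_mul_le _ _).trans (mul_le_mul ha hb (norm_nonneg _) hα)
    have h2 : ‖(a - 1) * (b - 1) + (a - 1) + (b - 1)‖ ≤ ‖(a - 1) * (b - 1)‖ + ‖a - 1‖ + ‖b - 1‖ :=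
      (norm_add_le _ _).trans (add_le_add (norm_add_le _ _) le_rfl)
    rw [hid]
    linarith
  -- the two end factors: `‖(V⁻¹S)·ρ̄⁻¹ − 1‖ ≤ ω` and `‖ρ̄·(S⁻¹V) − 1‖ ≤ ω`, `ω = φ + 6ψ + φ·6ψ`
  have hx : ‖(((V (m + 1) c.src)⁻¹ * toUT (shearRIter (avOfRecord F N K) (fun i => symCd F N K i) (loopAvgBlockOp expMeanLogSU) (gaugeAct u U) (m + 1)) c.src *
        (toUT (gaugeAvgIter (loopAvgBlockOp expMeanLogSU) (fun x => blockLift (m + 1) h x * w x * (u x)⁻¹) (m + 1)) c.src)⁻¹ : (Matrix (Fin N) (Fin N) ℂ)ˣ) :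
          Matrix (Fin N) (Fin N) ℂ) - 1‖ ≤
      100 * (240 * ((((F.P K).d + 2) * (F.P K).L : ℕ) : ℝ) ^ 2 * (κ * ε' * ((F.P K).L : ℝ))) ^ 2 + 6 * ψ +
        100 * (240 * ((((F.P K).d + 2) * (F.P K).L : ℕ) : ℝ) ^ 2 * (κ * ε' * ((F.P K).L : ℝ))) ^ 2 * (6 * ψ) := by
    rw [Units.val_mul]
    refine two _ _ ?_ ?_ hφ0
    · rw [norm_inv_mul_toUT_sub_one_eq _ _ (hVu c.src hgs)]
      exact hφs
    · have h := norm_toUT_inv_mul_sub_one_eq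
        (gaugeAvgIter (loopAvgBlockOp expMeanLogSU) (fun x => blockLift (m + 1) h x * w x * (u x)⁻¹) (m + 1)) c.src (1 : (Matrix (Fin N) (Fin N) ℂ)ˣ)
      rw [mul_one, Units.val_one] at h
      rw [h, norm_sub_rev]; exact hρs
  have hz : ‖((toUT (gaugeAvgIter (loopAvgBlockOp expMeanLogSU) (fun x => blockLift (m + 1) h x * w x * (u x)⁻¹) (m + 1)) c.tgt *
        (toUT (shearRIter (avOfRecord F N K) (fun i => symCd F N K i) (loopAvgBlockOp expMeanLogSU) (gaugeAct u U) (m + 1)) c.tgt)⁻¹ * V (m + 1) c.tgt :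
          (Matrix (Fin N) (Fin N) ℂ)ˣ) : Matrix (Fin N) (Fin N) ℂ) - 1‖ ≤
      100 * (240 * ((((F.P K).d + 2) * (F.P K).L : ℕ) : ℝ) ^ 2 * (κ * ε' * ((F.P K).L : ℝ))) ^ 2 + 6 * ψ +
        100 * (240 * ((((F.P K).d + 2) * (F.P K).L : ℕ) : ℝ) ^ 2 * (κ * ε' * ((F.P K).L : ℝ))) ^ 2 * (6 * ψ) := by
    rw [mul_assoc, Units.val_mul]
    have hb : ‖((((toUT (shearRIter (avOfRecord F N K) (fun i => symCd F N K i) (loopAvgBlockOp expMeanLogSU) (gaugeAct u U) (m + 1)) c.tgt)⁻¹ * V (m + 1) c.tgt :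
        (Matrix (Fin N) (Fin N) ℂ)ˣ)) : Matrix (Fin N) (Fin N) ℂ) - 1‖ ≤ 100 * (240 * ((((F.P K).d + 2) * (F.P K).L : ℕ) : ℝ) ^ 2 * (κ * ε' * ((F.P K).L : ℝ))) ^ 2 := by
      rw [norm_toUT_inv_mul_sub_one_eq]; exact hφt
    have h3 := two _ _ hρt hb (by positivity)
    refine h3.trans (le_of_eq ?_)
    ring
  rw [hidc, Units.val_mul, Units.val_mul]
  exact norm_conj3_sub_one_le hx hE hz

end Record

end Summit.QuantumFields.YangMills.BalabanUVNodes.N07SymNearRowsTopPhi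

end
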